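import Summits.ResolutionOfSingularities.ResolutionOfSingularities.Theorems.FrobeniusLadderFInjectiveMacaulayficationCIToricChartFedder
import Summits.ResolutionOfSingularities.ResolutionOfSingularities.Theorems.FrobeniusLadderFInjectiveMacaulayficationFrobeniusPowerOfFedderAt
import Summits.ResolutionOfSingularities.ResolutionOfSingularities.Theorems.FrobeniusLadderFInjectiveMacaulayficationCIFedderAtMaximalIdeal
import Mathlib.RingTheory.Finiteness.Defs
import Mathlib.RingTheory.Polynomial.Basic
import HarnessLib

/-!
# (G4ᶜⁱ) THE CI CHART CLAUSE OVER THE ORIGIN = C2ᶜⁱ + C3a + Fedder for complete intersections at a maximal ideal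

Support file for crux stmt-ResolutionOfSingularities-15315 (`FrobeniusLadder.FInjectiveMacaulayfication`), chain w45a, seat
res-L1-w45a-stub-6 (res-D-pv-018, D→L convert), file 6 of the CI-CN engine (idea-1 card 4, `Sketch-L1-idea-1.lean` r4 §9
(G4ᶜⁱ) `ciChartClause`). [OURS · L1 W4.5a] — NOT a statement of the manuscript [claim: Hironaka2017]; AI-written, weaker than
expert review.

One vertex chart `θ : X_j ↦ ∏ᵢ y_i^(V i j)` (`V` unimodular) of a monomial blow-up of `𝔸ⁿ`, and a COMPLETE INTERSECTION
`X = V(F₁, …, F_r)` with chart strict transforms `θ F_l = y^(d_l) · g_l`; CI face certificates (Fedder's test for the PRODUCT of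
the `w_S`-initial forms at their common torus zeros, every strictly positive row-subset weight `w_S`, over every field
extension); a simultaneous minimiser of all rows on each `supp F_l`; and EXPECTED DIMENSION `dim (k[y]/(g))_Q + r = n` at the
maximal ideal `Q ∋ θ(X_j) (∀ j)`. CLAIM (`ciChartClause`): `(k[y]/(g₁, …, g_r))_Q` satisfies the per-stalk clause of the crux
(every system of parameters weakly regular with Frobenius closed ideal).

Proof = stub-3's `CNChartClause.cnChartClause` (p494458) with `f ↦ (F_l)`, `g ↦ ∏ g_l`: `P := Q ∩ k[y]`, `K := k[y]/P`,
tautological point `a`, `S := {i : aᵢ = 0}` (non-empty, meets every column); (C2ᶜⁱ) `CIToricChartFedder.ciToricChartFedder`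
gives Fedder's test for `∏ (g_l ⊗ K)` at `a`; (C3a) `FrobeniusPowerOfFedderAt.frobeniusPower_of_fedderAt` turns it into
`(∏ g_l)^(p-1) ∉ P^[p]`, a fortiori `∉ (aᵢ^p)` for generators `(aᵢ)` of `P`; (C3ᶜⁱ-pt)
`CIFedderAtMaximalIdeal.ci_fedderAtMaximalIdeal` is the clause. Also `ci_fedderAtMaximalIdeal_span` = file 4 for a
`Fin r`-indexed family (`Ideal.span (Set.range g)` presentation).

No definitions, no named facts; glue. [folklore]
-/

-- single-problem summit: the doubled namespace component is forced
set_option linter.dupNamespace false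

noncomputable section

namespace Summit.ResolutionOfSingularities.ResolutionOfSingularities.Theorems.FInjectiveMacaulayfication.CIChartClause

open MvPolynomial
open Summit.ResolutionOfSingularities.ResolutionOfSingularities.Theorems.FInjectiveMacaulayfication
open Literature.RingTheory.TightClosure

/-- **Fedder for a complete intersection at a closed point, any presentation of the ideal**: file 4's
`CIFedderAtMaximalIdeal.ci_fedderAtMaximalIdeal` for an ideal `I` that EQUALS `Ideal.ofList gs` (so that consumers working with
`Ideal.span (Set.range g)` need no transport). [cite: Fedder1983, Prop. 1.7, Thm. 1.12 and Prop. 2.1] -/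
theorem ci_fedderAtMaximalIdeal_of_eq (p : ℕ) [Fact p.Prime] (k : Type) [Field k] [CharP k p] (n m : ℕ)
    (a : Fin m → MvPolynomial (Fin n) k) (gs : List (MvPolynomial (Fin n) k)) (I : Ideal (MvPolynomial (Fin n) k))
    (hI : Ideal.ofList gs = I) (Q : Ideal (MvPolynomial (Fin n) k ⧸ I)) [Q.IsMaximal]
    (hQ : Q.comap (Ideal.Quotient.mk I) = Ideal.span (Set.range a))
    (hfed : gs.prod ^ (p - 1) ∉ Ideal.span (Set.range fun i : Fin m => a i ^ p))
    (hdim : ringKrullDim (Localization.AtPrime Q) + (gs.length : WithBot ℕ∞) = (n : WithBot ℕ∞)) :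
    ∀ d : ℕ, ringKrullDim (Localization.AtPrime Q) = d → ∀ s : Fin d → Localization.AtPrime Q,
      (Ideal.span (Set.range s)).radical.IsMaximal →
        RingTheory.Sequence.IsWeaklyRegular (Localization.AtPrime Q) (List.ofFn s) ∧
        ∀ y : Localization.AtPrime Q, (∃ e : ℕ, y ^ p ^ e ∈ Ideal.span
          ((fun z : Localization.AtPrime Q => z ^ p ^ e) ''
            (Ideal.span (Set.range s) : Set (Localization.AtPrime Q)))) → y ∈ Ideal.span (Set.range s) := by
  subst hI
  exact CIFedderAtMaximalIdeal.ci_fedderAtMaximalIdeal k n m p a gs Q hQ hfed hdim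

/-- **(C3ᶜⁱ-pt, `Fin r` form) Fedder for a complete intersection `(g₁, …, g_r)` at a closed point** (idea-1 r4 §9
`ciFedderAtMaximalIdeal`, with the sketch's `InlineClause` unfolded): contraction `(a₁, …, a_m)`, `(∏ g_l)^(p-1) ∉ (aᵢ^p)`,
`dim (k[y]/(g))_Q + r = n` ⇒ the per-stalk clause for `(k[y]/(g))_Q`. [cite: Fedder1983, Prop. 1.7, Thm. 1.12 and Prop. 2.1] -/
theorem ci_fedderAtMaximalIdeal_span : ∀ (p : ℕ) [Fact p.Prime] (k : Type) [Field k] [CharP k p] (n m r : ℕ)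
    (a : Fin m → MvPolynomial (Fin n) k) (g : Fin r → MvPolynomial (Fin n) k)
    (Q : Ideal (MvPolynomial (Fin n) k ⧸ Ideal.span (Set.range g))) [Q.IsMaximal],
    Q.comap (Ideal.Quotient.mk (Ideal.span (Set.range g))) = Ideal.span (Set.range a) →
    ringKrullDim (Localization.AtPrime Q) + (r : WithBot ℕ∞) = (n : WithBot ℕ∞) →
    (∏ l, g l) ^ (p - 1) ∉ Ideal.span (Set.range fun i : Fin m => a i ^ p) →
    ∀ d : ℕ, ringKrullDim (Localization.AtPrime Q) = d → ∀ s : Fin d → Localization.AtPrime Q,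
      (Ideal.span (Set.range s)).radical.IsMaximal →
        RingTheory.Sequence.IsWeaklyRegular (Localization.AtPrime Q) (List.ofFn s) ∧
        ∀ y : Localization.AtPrime Q, (∃ e : ℕ, y ^ p ^ e ∈ Ideal.span
          ((fun z : Localization.AtPrime Q => z ^ p ^ e) ''
            (Ideal.span (Set.range s) : Set (Localization.AtPrime Q)))) → y ∈ Ideal.span (Set.range s) := by
  intro p _ k _ _ n m r a g Q _ hQ hdim hfed
  -- `Ideal.ofList (List.ofFn g) = Ideal.span (Set.range g)` (cf. `NesterenkoMultiplicity.ofList_ofFn`)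
  have hofList : Ideal.ofList (List.ofFn g) = Ideal.span (Set.range g) := by
    have h : {x : MvPolynomial (Fin n) k | x ∈ List.ofFn g} = Set.range g := Set.ext fun x => by
      simp only [Set.mem_setOf_eq, List.mem_ofFn', Set.mem_range]
    change Ideal.span {x | x ∈ List.ofFn g} = Ideal.span (Set.range g)
    rw [h]
  refine ci_fedderAtMaximalIdeal_of_eq p k n m a (List.ofFn g) (Ideal.span (Set.range g))
    hofList Q hQ ?_ ?_
  · rw [List.prod_ofFn]; exact hfed
  · rw [List.length_ofFn]; exact hdim

/-- **(G4ᶜⁱ) THE CI CHART CLAUSE OVER THE ORIGIN** (idea-1 `Sketch-L1-idea-1.lean` r4 §9 `ciChartClause`; the sketch's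
`InlineClause` unfolded, and the expected-dimension binder in the intrinsic form `dim (k[y]/(g))_Q + r = n`, which the
sketch's `(g, y_S)`-form implies). One vertex chart: `V` unimodular, `θ F_l = y^(d_l) · g_l`, the CI FACE CERTIFICATES (Fedder
form for the PRODUCT of the `w_S`-initial forms on their common torus zeros, over every field extension) for every STRICTLY
POSITIVE row-subset weight `w_S = Σ_(i ∈ S) V_i`, a simultaneous minimiser of all rows on each `supp F_l`, and expected
dimension at the maximal ideal `Q ∋ θ(X_j) (∀ j)`. Then `(k[y]/(g₁, …, g_r))_Q` satisfies the per-stalk clause of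
`FrobeniusLadder.FInjectiveMacaulayfication` (every system of parameters weakly regular with Frobenius closed ideal).
[folklore; cite: Fedder1983, Prop. 1.7, Thm. 1.12 and Prop. 2.1] -/
theorem ciChartClause : ∀ (p : ℕ) [Fact p.Prime] (k : Type) [Field k] [CharP k p] (n r : ℕ), 0 < n →
    ∀ (F : Fin r → MvPolynomial (Fin n) k) (V : Matrix (Fin n) (Fin n) ℕ), IsUnit (V.map (Nat.cast : ℕ → ℤ)).det →
    ∀ (d : Fin r → (Fin n →₀ ℕ)) (g : Fin r → MvPolynomial (Fin n) k),
    (∀ l, MvPolynomial.aeval (fun j : Fin n => ∏ i : Fin n, (MvPolynomial.X i : MvPolynomial (Fin n) k) ^ V i j) (F l) =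
      MvPolynomial.monomial (d l) 1 * g l) →
    (∀ S : Finset (Fin n), (∀ j : Fin n, 0 < ∑ i ∈ S, V i j) →
      ∀ (D : Fin r → ℕ),
      (∀ l, MvPolynomial.weightedHomogeneousComponent (fun j : Fin n => ∑ i ∈ S, V i j) (D l) (F l) ≠ 0 ∧
          ∀ D' < D l, MvPolynomial.weightedHomogeneousComponent (fun j : Fin n => ∑ i ∈ S, V i j) D' (F l) = 0) →
        ∀ (K : Type) [Field K] [Algebra k K] (b : Fin n → K), (∀ i, b i ≠ 0) →
          (∀ l, MvPolynomial.aeval b (MvPolynomial.weightedHomogeneousComponent (fun j : Fin n => ∑ i ∈ S, V i j) (D l) (F l)) = 0) →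
          (∏ l, MvPolynomial.map (algebraMap k K)
              (MvPolynomial.weightedHomogeneousComponent (fun j : Fin n => ∑ i ∈ S, V i j) (D l) (F l))) ^ (p - 1) ∉
            Ideal.span (Set.range fun i : Fin n => (MvPolynomial.X i - MvPolynomial.C (b i)) ^ p)) →
    (∀ l, ∃ m ∈ (F l).support, ∀ i : Fin n, ∑ j : Fin n, V i j * m j = d l i) →
    ∀ (Q : Ideal (MvPolynomial (Fin n) k ⧸ Ideal.span (Set.range g))) [Q.IsMaximal],
    (∀ j : Fin n, Ideal.Quotient.mk (Ideal.span (Set.range g)) (∏ i : Fin n, MvPolynomial.X i ^ V i j) ∈ Q) →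
    ringKrullDim (Localization.AtPrime Q) + (r : WithBot ℕ∞) = (n : WithBot ℕ∞) →
    ∀ d : ℕ, ringKrullDim (Localization.AtPrime Q) = d → ∀ s : Fin d → Localization.AtPrime Q,
      (Ideal.span (Set.range s)).radical.IsMaximal →
        RingTheory.Sequence.IsWeaklyRegular (Localization.AtPrime Q) (List.ofFn s) ∧
        ∀ y : Localization.AtPrime Q, (∃ e : ℕ, y ^ p ^ e ∈ Ideal.span
          ((fun z : Localization.AtPrime Q => z ^ p ^ e) ''
            (Ideal.span (Set.range s) : Set (Localization.AtPrime Q)))) → y ∈ Ideal.span (Set.range s) := by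
  intro p _ k _ _ n r hn F V hV dv g hθ hCN hface Q _ hXQ hdim
  classical
  -- the contraction `P` of `Q` to `k[y]`, its residue field `K` and the tautological point `a`
  set P : Ideal (MvPolynomial (Fin n) k) := Q.comap (Ideal.Quotient.mk (Ideal.span (Set.range g))) with hP_def
  haveI hPmax : P.IsMaximal := Ideal.comap_isMaximal_of_surjective _ Ideal.Quotient.mk_surjective
  letI : Field (MvPolynomial (Fin n) k ⧸ P) := Ideal.Quotient.field P
  haveI : CharP (MvPolynomial (Fin n) k ⧸ P) p :=
    charP_of_injective_algebraMap (algebraMap k (MvPolynomial (Fin n) k ⧸ P)).injective p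
  have hgP : ∀ l, g l ∈ P := by
    intro l
    rw [hP_def, Ideal.mem_comap,
      Ideal.Quotient.eq_zero_iff_mem.mpr (Ideal.subset_span (Set.mem_range_self l))]
    exact Q.zero_mem
  -- `aeval a = mk_P` on `k[y]`
  have haev : ∀ q : MvPolynomial (Fin n) k,
      MvPolynomial.aeval (fun i : Fin n => Ideal.Quotient.mk P (MvPolynomial.X i)) q = Ideal.Quotient.mk P q := by
    intro q
    have h : (MvPolynomial.aeval (R := k) (fun i : Fin n => Ideal.Quotient.mk P (MvPolynomial.X i))) =
        Ideal.Quotient.mkₐ k P := MvPolynomial.algHom_ext fun i => by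
      rw [MvPolynomial.aeval_X, Ideal.Quotient.mkₐ_eq_mk]
    rw [h, Ideal.Quotient.mkₐ_eq_mk]
  have ha : ∀ l, MvPolynomial.aeval (fun i : Fin n => Ideal.Quotient.mk P (MvPolynomial.X i)) (g l) = 0 := by
    intro l
    rw [haev, Ideal.Quotient.eq_zero_iff_mem]
    exact hgP l
  -- the vanishing set `S` of the coordinates: every column of `V` meets it, and it is non-empty
  set S : Finset (Fin n) := Finset.univ.filter fun i => Ideal.Quotient.mk P (MvPolynomial.X i) = 0 with hS_def
  have hS : ∀ i, i ∈ S ↔ Ideal.Quotient.mk P (MvPolynomial.X i) = 0 := fun i => by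
    rw [hS_def, Finset.mem_filter]
    exact ⟨fun h => h.2, fun h => ⟨Finset.mem_univ i, h⟩⟩
  have hcol : ∀ j : Fin n, ∃ i ∈ S, 0 < V i j := by
    intro j
    have h1 : Ideal.Quotient.mk P (∏ i : Fin n, MvPolynomial.X i ^ V i j) = 0 := by
      rw [Ideal.Quotient.eq_zero_iff_mem, hP_def, Ideal.mem_comap]
      exact hXQ j
    rw [map_prod, Finset.prod_eq_zero_iff] at h1
    obtain ⟨i, -, hi⟩ := h1
    rw [map_pow] at hi
    have hV0 : V i j ≠ 0 := by
      intro h0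
      rw [h0, pow_zero] at hi
      exact one_ne_zero hi
    exact ⟨i, (hS i).mpr (pow_eq_zero_iff hV0 |>.mp hi), Nat.pos_of_ne_zero hV0⟩
  have hSpos : ∀ j : Fin n, 0 < ∑ i ∈ S, V i j := by
    intro j
    obtain ⟨i, hi, hVij⟩ := hcol j
    exact lt_of_lt_of_le hVij (Finset.single_le_sum (fun i _ => Nat.zero_le (V i j)) hi)
  have hSne : S.Nonempty := by
    obtain ⟨i, hi, -⟩ := hcol ⟨0, hn⟩
    exact ⟨i, hi⟩
  -- (C2ᶜⁱ): Fedder's test for `∏ (g_l ⊗ K)` at `a`, with the initial degrees `D l = Σ_{i∈S} d_l i`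
  have hfedK := CIToricChartFedder.ciToricChartFedder p n r k F V hV dv g hθ (MvPolynomial (Fin n) k ⧸ P)
    (fun i : Fin n => Ideal.Quotient.mk P (MvPolynomial.X i)) S hS hSne (fun l => ∑ i ∈ S, dv l i)
    (fun l => ToricChartFedder.isInitialDegree_face V hV (F l) (g l) (dv l) (hθ l) S
      (by obtain ⟨m, hm, hmin⟩ := hface l; exact ⟨m, hm, fun i _ => hmin i⟩))
    (hCN S hSpos _ (fun l => ToricChartFedder.isInitialDegree_face V hV (F l) (g l) (dv l) (hθ l) S
      (by obtain ⟨m, hm, hmin⟩ := hface l; exact ⟨m, hm, fun i _ => hmin i⟩)))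
    (fun l => by obtain ⟨m, hm, hmin⟩ := hface l; exact ⟨m, hm, fun i _ => hmin i⟩) ha
  rw [← map_prod] at hfedK
  -- (C3a): `(∏ g_l)^(p-1) ∉ P^[p]`
  have hfrob := FrobeniusPowerOfFedderAt.frobeniusPower_of_fedderAt p k n (∏ l, g l) P hfedK
  -- generators of `P` and Fedder for the complete intersection at the maximal ideal
  obtain ⟨m, gens, hgens⟩ := Submodule.fg_iff_exists_fin_generating_family.mp
    ((isNoetherianRing_iff_ideal_fg _).mp inferInstance P)
  have hfed : (∏ l, g l) ^ (p - 1) ∉ Ideal.span (Set.range fun i : Fin m => gens i ^ p) := by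
    intro h
    apply hfrob
    refine (Ideal.span_le.mpr ?_) h
    rintro _ ⟨i, rfl⟩
    exact pow_mem_frobeniusPower (by rw [← hgens]; exact Submodule.subset_span ⟨i, rfl⟩)
  exact ci_fedderAtMaximalIdeal_span p k n m r gens g Q hgens.symm hdim hfed

end Summit.ResolutionOfSingularities.ResolutionOfSingularities.Theorems.FInjectiveMacaulayfication.CIChartClause

end
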